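import Mathlib
import HarnessLib.Audit
import Summits.PneNP.PneNP.Theorems.PstarSlackTwoDirty

/-!
# No centre at slack two: the clean case, by deleting almost all fat chords at once (ROUND-24, O1; all sharing patterns; memo g25 §50)

FRONTIER range-avoidance ladder, rung F-N3, ROUND 24 (cell `pnp-ideate`, prover-2 memo `g25/O1-XORSPLIT-g25.md` §50; typed targets
`PstarCoreBoundTargets.TerminalFive` / `TerminalPeelable` (p646951); restricted-model proof complexity — nothing here bears on `P` versus `NP`).

`PstarSlackTwoDirty` leaves, at boundary slack `t = 2·#bdry K − 3·#K = 2`, the X-connected cores all of whose chords are outside-gated.  This file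
closes that case, hence slack two entirely, for every sharing pattern:

* `degIn_sdiff`, **`card_bdry_sdiff_add_le`** (the DELETION INEQUALITY): deleting a set `R` of chords such that every endpoint `w` of a member of `R`
  keeps `degIn K w ≥ 2 + #(members of R at w)` lowers `#bdry` by at least `2·#R`; with expansion of `K ∖ R`, `#R ≤ t`.
* **`no_centre_at_slack_two_clean`**: inside the induction, X-connected, `2·#bdry K = 3·#K + 2`, every chord outside-gated ⟹ no centre.  With `C''`
  the FAT clean chords (no endpoint of degree two), `Y` the non-centre vertices of degree `≠ 2`, the refined injection gives `#C'' ≥ 5 + #Y`; let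
  `W₁` be the vertices all of whose members but one are fat (`W₁ ⊆ Y`); keeping ONE fat chord at each vertex of `W₁` and deleting the other fat
  chords is admissible for the deletion inequality, so `#C'' − #W₁ ≤ 2`: `5 + #Y ≤ #C'' ≤ 2 + #Y`.
* `no_centre_at_slack_two`: both slack-two cases together.
-/

set_option linter.dupNamespace false -- `Summit.PneNP.PneNP.…`: summit = sub-problem name (D-0017 single-conjunct layout)

open Finset Literature.Computability.Complexity
open Summit.PneNP.PneNP.Theorems.PstarTyped (Typed)
open Summit.PneNP.PneNP.Theorems.PstarSALevel (varSet bdry BoundaryExpanding SimpleOverlap)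
open Summit.PneNP.PneNP.Theorems.PstarSAClosure (degIn mem_bdry_iff)
open Summit.PneNP.PneNP.Theorems.PstarXCore (xpair mem_xpair xverts)
open Summit.PneNP.PneNP.Theorems.PstarCentreFree (vars_mem_varSet)
open Summit.PneNP.PneNP.Theorems.PstarCoreBound (XorClosed)
open Summit.PneNP.PneNP.Theorems.PstarChordRepair (IsChord)
open Summit.PneNP.PneNP.Theorems.PstarCoreBoundTargets (Terminal nonchords mem_nonchords)
open Summit.PneNP.PneNP.Theorems.PstarSharingBound (sharedSlots card_bdry_add_card_sharedSlots_le)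
open Summit.PneNP.PneNP.Theorems.PstarChordBridgeTools (xpdeg)
open Summit.PneNP.PneNP.Theorems.PstarChordBridgeExchange (mem_xverts_iff)
open Summit.PneNP.PneNP.Theorems.PstarNorUnitCoverTools (exists_ne_of_two_le_xpdeg)
open Summit.PneNP.PneNP.Theorems.PstarChordReadOutside (OutsideGated)
open Summit.PneNP.PneNP.Theorems.PstarCleanChordCount (card_nonchords_le_card_sharedSlots)
open Summit.PneNP.PneNP.Theorems.PstarNoFreeVertex (covered_of_terminal mem_varSet_of_mem_xpair mem_xpair_of_mem_varSet)
open Summit.PneNP.PneNP.Theorems.PstarSkeletonSpan (XConnected skel mem_skel card_xverts_le_card_skel xverts_mono)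
open Summit.PneNP.PneNP.Theorems.PstarMaxSharingCentre (card_bdry_erase_le)
open Summit.PneNP.PneNP.Theorems.PstarSlackTools (three_le_card_xverts_of_leafless two_le_degIn)
open Summit.PneNP.PneNP.Theorems.PstarSlackTwoTools (card_deg2_chords_le_filter)
open Summit.PneNP.PneNP.Theorems.PstarSlackTwoDirty (no_centre_at_slack_two_dirty)

namespace Summit.PneNP.PneNP.Theorems.PstarSlackTwoClean

variable {n m : ℕ}

/-! ## The deletion inequality -/

/-- `degIn` of a subfamily `K ∖ R`. -/
theorem degIn_sdiff (I : LocalMap 4 n m) {K R : Finset (Fin m)} (hRK : R ⊆ K) (w : Fin n) :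
    degIn I (K \ R) w + (R.filter fun j => w ∈ varSet I j).card = degIn I K w := by
  classical
  unfold PstarSAClosure.degIn
  rw [← card_union_of_disjoint (disjoint_filter_filter sdiff_disjoint), ← filter_union, sdiff_union_of_subset hRK]

/-- **THE DELETION INEQUALITY.**  On a pure instance, deleting from `K` a set `R` of chords of `K` such that every XOR endpoint `w` of a member of `R`
has `degIn K w ≥ 2 + #(members of R reading w)` lowers the boundary by at least `2·#R`. -/
theorem card_bdry_sdiff_add_le (I : LocalMap 4 n m) (hI : I.IsPure xorAndPred) (K : Finset (Fin m)) :
    ∀ R : Finset (Fin m), R ⊆ K → (∀ c ∈ R, IsChord I K c) →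
      (∀ c ∈ R, ∀ w ∈ xpair I c, 2 + (R.filter fun j => w ∈ varSet I j).card ≤ degIn I K w) →
      (bdry I (K \ R)).card + 2 * R.card ≤ (bdry I K).card := by
  classical
  intro R
  induction R using Finset.induction_on with
  | empty => intro _ _ _; simp
  | insert c R' hc ih =>
    intro hRK hch hdeg
    have hR'K : R' ⊆ K := fun j hj => hRK (mem_insert_of_mem hj)
    have ih' := ih hR'K (fun c' hc' => hch c' (mem_insert_of_mem hc')) fun c' hc' w hw =>
      le_trans (Nat.add_le_add_left (card_le_card (filter_subset_filter _ (subset_insert c R'))) 2) (hdeg c' (mem_insert_of_mem hc') w hw)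
    have hcK : c ∈ K := hRK (mem_insert_self c R')
    set E := K \ R' with hE
    have hcE : c ∈ E := mem_sdiff.2 ⟨hcK, hc⟩
    -- `c` is a chord of `E`
    have hchE : IsChord I E c := by
      have key : ∀ s : Fin 4, I.vars c s ∈ bdry I K → I.vars c s ∈ bdry I E := by
        intro s hb
        rw [mem_bdry_iff] at hb ⊢
        have h1 := degIn_sdiff I hR'K (I.vars c s)
        have hpos : 0 < degIn I E (I.vars c s) := by
          unfold PstarSAClosure.degIn; exact card_pos.2 ⟨c, mem_filter.2 ⟨hcE, vars_mem_varSet I c s⟩⟩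
        rw [← hE] at h1
        omega
      exact ⟨key 2 (hch c (mem_insert_self c R')).1, key 3 (hch c (mem_insert_self c R')).2⟩
    have h1 := card_bdry_erase_le I hI hcE hchE
    -- no endpoint of `c` has degree two in `E`
    have hX : ((xpair I c).filter fun w => degIn I E w = 2).card = 0 := by
      refine card_eq_zero.2 (filter_eq_empty_iff.2 fun w hw h2 => ?_)
      have hd := hdeg c (mem_insert_self c R') w hw
      have hs := degIn_sdiff I hR'K w
      rw [← hE] at hs
      have hins : ((insert c R').filter fun j => w ∈ varSet I j).card = (R'.filter fun j => w ∈ varSet I j).card + 1 := by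
        rw [filter_insert, if_pos (mem_varSet_of_mem_xpair hw), card_insert_of_notMem fun h => hc (mem_filter.1 h).1]
      omega
    rw [hX] at h1
    rw [sdiff_insert, card_insert_of_notMem hc]
    change (bdry I (E.erase c)).card + 2 * (R'.card + 1) ≤ (bdry I K).card
    omega

/-! ## The theorem -/

variable {I : LocalMap 4 n m} {r : ℕ} {y : Fin m → Bool} {K : Finset (Fin m)} {w₁ w₂ : Finset (Fin n) × Finset (Fin m) × Bool}

/-- **NO CENTRE AT SLACK TWO, CLEAN CASE** (all sharing patterns; inside the core-bound induction).  An X-connected terminal core with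
`2·#bdry K = 3·#K + 2` all of whose chords are outside-gated has no non-empty leafless set of non-chords. -/
theorem no_centre_at_slack_two_clean (hI : I.IsPure xorAndPred) (hT : Typed I) (hS : SimpleOverlap I) (hB : BoundaryExpanding r I)
    (ht : Terminal I r y K w₁ w₂)
    (hIH : ∀ c ∈ K, ∀ K₀ ⊆ K.erase c, ∀ d d' : Finset (Fin n) × Finset (Fin m) × Bool, Terminal I r y K₀ d d' → K₀.card ≤ 5)
    (hconn : XConnected I K) (hslack : 2 * (bdry I K).card = 3 * K.card + 2)
    (hclean : ∀ c ∈ K, IsChord I K c → OutsideGated I K (w₁.2.1 ∪ w₂.2.1) c) :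
    ¬ ∃ S ⊆ K, S.Nonempty ∧ (∀ w ∈ xverts I S, 2 ≤ xpdeg I S w) ∧ ∀ f ∈ S, ¬ IsChord I K f := by
  classical
  rintro ⟨S, hSK, hSne, hSL, hSnc⟩
  have hX : XorClosed I K := ht.2.1
  have hKr : K.card < r := ht.2.2.1
  set M := w₁.2.1 ∪ w₂.2.1 with hM
  have hbs := card_bdry_add_card_sharedSlots_le I K hX
  have hN := card_nonchords_le_card_sharedSlots I K
  have h2N : 2 * (nonchords I K).card + 2 ≤ K.card := by omega
  -- the skeleton is the set of non-chords
  have hskel : skel I K M ⊆ nonchords I K := by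
    intro f hf
    obtain ⟨hfK, hnot⟩ := (mem_skel I).1 hf
    exact (mem_nonchords I).2 ⟨hfK, fun hch => hnot ⟨hch, hclean f hfK hch⟩⟩
  have hu : (xverts I K).card ≤ (nonchords I K).card :=
    (card_xverts_le_card_skel hI hT hS hB ht hIH hconn ⟨S, hSK, hSne, hSL, hSnc⟩).trans (card_le_card hskel)
  set C := K.filter fun c => IsChord I K c ∧ OutsideGated I K M c with hC
  have hsplit : C.card + (nonchords I K).card = K.card := by
    have h1 := card_filter_add_card_filter_not (s := K) (fun c => IsChord I K c)
    have e : (K.filter fun c => ¬ IsChord I K c) = nonchords I K := by ext f; rw [mem_filter, mem_nonchords]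
    have e' : (K.filter fun c => IsChord I K c) = C := by
      rw [hC]; exact filter_congr fun c hc => ⟨fun h => ⟨h, hclean c hc h⟩, fun h => h.1⟩
    rw [e, e'] at h1
    exact h1
  set C₂ := C.filter fun c => ∃ w ∈ xpair I c, degIn I K w = 2 with hC₂
  set C'' := C.filter fun c => ¬ ∃ w ∈ xpair I c, degIn I K w = 2 with hC''
  have hCsplit : C₂.card + C''.card = C.card := card_filter_add_card_filter_not _
  have hcov := covered_of_terminal hI hT hS hB ht
  have hC₂mem : ∀ c ∈ C₂, c ∈ K ∧ IsChord I K c ∧ OutsideGated I K M c ∧ ∃ w ∈ xpair I c, degIn I K w = 2 := fun c hc => by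
    obtain ⟨hcC, hw⟩ := mem_filter.1 hc
    obtain ⟨hcK, hch, hO⟩ := mem_filter.1 hcC
    exact ⟨hcK, hch, hO, hw⟩
  have h3 := three_le_card_xverts_of_leafless I hI hS hSne hSL
  -- refined injection: `#C'' ≥ 5 + #Y`
  set Y := (xverts I K \ xverts I S).filter fun v => ¬ degIn I K v = 2 with hY
  have hC₂f := card_deg2_chords_le_filter I hI hcov hC₂mem hSK hSL hSnc
  have hYsplit : ((xverts I K \ xverts I S).filter fun v => degIn I K v = 2).card + Y.card = (xverts I K \ xverts I S).card :=
    card_filter_add_card_filter_not _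
  have hVS : (xverts I K \ xverts I S).card + (xverts I S).card = (xverts I K).card := card_sdiff_add_card_eq_card (xverts_mono I hSK)
  have hC''5 : 5 + Y.card ≤ C''.card := by omega
  -- members and fat chords at a vertex
  have memC'' : ∀ c ∈ C'', c ∈ K ∧ IsChord I K c ∧ OutsideGated I K M c ∧ ∀ w ∈ xpair I c, degIn I K w ≠ 2 := fun c hc => by
    obtain ⟨hcC, hno⟩ := mem_filter.1 hc
    obtain ⟨hcK, hch, hO⟩ := mem_filter.1 hcC
    push Not at hno
    exact ⟨hcK, hch, hO, hno⟩
  -- at every XOR vertex: the fat chords reading it plus one non-clean member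
  have fat_lt : ∀ w ∈ xverts I K, (C''.filter fun j => w ∈ varSet I j).card + 1 ≤ degIn I K w := by
    intro w hw
    obtain ⟨f, hf, hwf, hnot⟩ := hcov w hw
    unfold PstarSAClosure.degIn
    have hfC : f ∉ C''.filter fun j => w ∈ varSet I j := fun h => by
      obtain ⟨-, hch, hO, -⟩ := memC'' f (mem_filter.1 h).1
      exact hnot ⟨hch, hO⟩
    calc (C''.filter fun j => w ∈ varSet I j).card + 1 = (insert f (C''.filter fun j => w ∈ varSet I j)).card := by
          rw [card_insert_of_notMem hfC]
      _ ≤ (K.filter fun j => w ∈ varSet I j).card := by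
          refine card_le_card fun j hj => ?_
          rcases mem_insert.1 hj with rfl | hj
          · exact mem_filter.2 ⟨hf, mem_varSet_of_mem_xpair hwf⟩
          · obtain ⟨hjC, hwj⟩ := mem_filter.1 hj
            exact mem_filter.2 ⟨(memC'' j hjC).1, hwj⟩
  -- `W₁`: the vertices all of whose members but one are fat chords
  set W₁ := (xverts I K).filter fun w => degIn I K w = (C''.filter fun j => w ∈ varSet I j).card + 1 with hW₁
  have hW₁fat : ∀ w ∈ W₁, ∃ c ∈ C'', w ∈ varSet I c := by
    intro w hw
    obtain ⟨hwK, hdw⟩ := mem_filter.1 hw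
    by_contra h
    push Not at h
    have h0 : (C''.filter fun j => w ∈ varSet I j).card = 0 := card_eq_zero.2 (filter_eq_empty_iff.2 fun j hj hwj => h j hj hwj)
    rw [h0] at hdw
    -- degree one: an XOR vertex of `K` on the boundary
    obtain ⟨f, hf, hwf⟩ := (mem_xverts_iff I K w).1 hwK
    have hb : w ∈ bdry I K := (mem_bdry_iff I K w).2 hdw
    rcases (mem_xpair I).1 hwf with h | h
    · exact hX f hf 0 (by decide) (h ▸ hb)
    · exact hX f hf 1 (by decide) (h ▸ hb)
  -- `W₁ ⊆ Y`
  have hW₁Y : W₁ ⊆ Y := by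
    intro w hw
    obtain ⟨hwK, hdw⟩ := mem_filter.1 hw
    obtain ⟨c, hc, hwc⟩ := hW₁fat w hw
    obtain ⟨hcK, hch, hO, hno⟩ := memC'' c hc
    have hwx : w ∈ xpair I c := by
      obtain ⟨f, hf, hwf⟩ := (mem_xverts_iff I K w).1 hwK
      rcases (mem_xpair I).1 hwf with h | h
      · rw [h]; exact mem_xpair_of_mem_varSet hT (s := 0) (by decide) (h ▸ hwc)
      · rw [h]; exact mem_xpair_of_mem_varSet hT (s := 1) (by decide) (h ▸ hwc)
    refine mem_filter.2 ⟨mem_sdiff.2 ⟨hwK, fun hwS => ?_⟩, hno w hwx⟩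
    -- a centre vertex carries two members of `S`, which are not fat chords
    obtain ⟨s₁, hs₁, -, hws₁⟩ := exists_ne_of_two_le_xpdeg I hI c (hSL w hwS)
    obtain ⟨s₂, hs₂, hs₂₁, hws₂⟩ := exists_ne_of_two_le_xpdeg I hI s₁ (hSL w hwS)
    have hsC : ∀ s ∈ S, s ∉ C''.filter fun j => w ∈ varSet I j := fun s hs h =>
      hSnc s hs (memC'' s (mem_filter.1 h).1).2.1
    have hle : (C''.filter fun j => w ∈ varSet I j).card + 2 ≤ degIn I K w := by
      unfold PstarSAClosure.degIn
      have hs₁f : s₁ ∉ C''.filter fun j => w ∈ varSet I j := hsC s₁ hs₁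
      have hs₂f : s₂ ∉ insert s₁ (C''.filter fun j => w ∈ varSet I j) := fun h => by
        rcases mem_insert.1 h with h | h
        · exact hs₂₁ h
        · exact hsC s₂ hs₂ h
      calc (C''.filter fun j => w ∈ varSet I j).card + 2 = (insert s₂ (insert s₁ (C''.filter fun j => w ∈ varSet I j))).card := by
            rw [card_insert_of_notMem hs₂f, card_insert_of_notMem hs₁f]
        _ ≤ (K.filter fun j => w ∈ varSet I j).card := by
            refine card_le_card fun j hj => ?_
            rcases mem_insert.1 hj with rfl | hj
            · exact mem_filter.2 ⟨hSK hs₂, mem_varSet_of_mem_xpair hws₂⟩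
            rcases mem_insert.1 hj with rfl | hj
            · exact mem_filter.2 ⟨hSK hs₁, mem_varSet_of_mem_xpair hws₁⟩
            · obtain ⟨hjC, hwj⟩ := mem_filter.1 hj
              exact mem_filter.2 ⟨(memC'' j hjC).1, hwj⟩
    omega
  -- keep one fat chord at each vertex of `W₁`, delete the other fat chords
  choose κ hκC hκw using hW₁fat
  obtain ⟨s₀, hs₀⟩ := hSne
  set kf : Fin n → Fin m := fun w => if h : w ∈ W₁ then κ w h else s₀ with hkf
  set Kept := W₁.image kf with hKept
  have hKeptC : Kept ⊆ C'' := by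
    intro j hj
    obtain ⟨w, hw, rfl⟩ := mem_image.1 hj
    simp only [hkf, dif_pos hw]
    exact hκC w hw
  have hKeptW : Kept.card ≤ W₁.card := card_image_le
  set R := C'' \ Kept with hR
  have hRK : R ⊆ K := fun j hj => (memC'' j (mem_sdiff.1 hj).1).1
  have hRch : ∀ c ∈ R, IsChord I K c := fun j hj => (memC'' j (mem_sdiff.1 hj).1).2.1
  have hRdeg : ∀ c ∈ R, ∀ w ∈ xpair I c, 2 + (R.filter fun j => w ∈ varSet I j).card ≤ degIn I K w := by
    intro c hc w hw
    have hcC'' : c ∈ C'' := (mem_sdiff.1 hc).1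
    have hwK : w ∈ xverts I K := (mem_xverts_iff I K w).2 ⟨c, (memC'' c hcC'').1, hw⟩
    have hsub : (R.filter fun j => w ∈ varSet I j) ⊆ C''.filter fun j => w ∈ varSet I j := filter_subset_filter _ sdiff_subset
    have hfl := fat_lt w hwK
    by_cases hwW : w ∈ W₁
    · -- the kept chord at `w` is fat, reads `w`, and is not deleted
      have hkw : kf w ∈ C''.filter fun j => w ∈ varSet I j := by
        simp only [hkf, dif_pos hwW]
        exact mem_filter.2 ⟨hκC w hwW, hκw w hwW⟩
      have hkR : kf w ∉ R.filter fun j => w ∈ varSet I j := fun h =>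
        (mem_sdiff.1 (mem_filter.1 h).1).2 (mem_image.2 ⟨w, hwW, rfl⟩)
      have hlt : (R.filter fun j => w ∈ varSet I j).card < (C''.filter fun j => w ∈ varSet I j).card :=
        card_lt_card ⟨hsub, fun h => hkR (h hkw)⟩
      have := (mem_filter.1 hwW).2
      omega
    · have hne : degIn I K w ≠ (C''.filter fun j => w ∈ varSet I j).card + 1 := fun h => hwW (mem_filter.2 ⟨hwK, h⟩)
      have := card_le_card hsub
      omega
  have hdel := card_bdry_sdiff_add_le I hI K R hRK hRch hRdeg
  have hexp := hB (K \ R) ((card_le_card sdiff_subset).trans hKr.le)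
  have hKR : (K \ R).card + R.card = K.card := card_sdiff_add_card_eq_card hRK
  have hR2 : R.card ≤ 2 := by omega
  have hRcard : R.card + Kept.card = C''.card := by rw [hR, card_sdiff_add_card_eq_card hKeptC]
  have hWY := card_le_card hW₁Y
  omega

/-- **NO CENTRE AT SLACK TWO** (all sharing patterns; inside the induction): both cases together. -/
theorem no_centre_at_slack_two (hI : I.IsPure xorAndPred) (hT : Typed I) (hS : SimpleOverlap I) (hB : BoundaryExpanding r I)
    (ht : Terminal I r y K w₁ w₂)
    (hIH : ∀ c ∈ K, ∀ K₀ ⊆ K.erase c, ∀ d d' : Finset (Fin n) × Finset (Fin m) × Bool, Terminal I r y K₀ d d' → K₀.card ≤ 5)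
    (hconn : XConnected I K) (hslack : 2 * (bdry I K).card = 3 * K.card + 2) :
    ¬ ∃ S ⊆ K, S.Nonempty ∧ (∀ w ∈ xverts I S, 2 ≤ xpdeg I S w) ∧ ∀ f ∈ S, ¬ IsChord I K f := by
  by_cases hclean : ∀ c ∈ K, IsChord I K c → OutsideGated I K (w₁.2.1 ∪ w₂.2.1) c
  · exact no_centre_at_slack_two_clean hI hT hS hB ht hIH hconn hslack hclean
  · push Not at hclean
    obtain ⟨d, hd, hch, hO⟩ := hclean
    exact no_centre_at_slack_two_dirty hI hT hS hB ht hIH hconn hslack ⟨d, hd, hch, hO⟩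

end Summit.PneNP.PneNP.Theorems.PstarSlackTwoClean
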